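import Mathlib.Analysis.SpecialFunctions.Pow.Real
import Mathlib.Data.Set.Finite.List
import Mathlib.Data.ZMod.ValMinAbs
import Mathlib.Data.ENNReal.Basic
import Literature.Barriers.CriticalPhenomena.RigorousRGSmallParameterTestFunctionNorm
import Literature.Barriers.CriticalPhenomena.RigorousRGSmallParameterPolymers
import HarnessLib

/-!
# `RigorousRGSmallParameter` (Slade, Theorem 1.4.1): the norms of Slade §6.2 — the field norm
# (6.29), the local norms (6.30), the regulators `G_j`, `G̃_j` (6.32), the regulator norms (6.33),
# and the `ℱ_j`, `𝒲_j` norms (6.35) on the space `𝒦_j`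

Companion ("proof architecture") file of
`Literature/Barriers/CriticalPhenomena/RigorousRGSmallParameter.lean`, on top of the `T_φ`
seminorm files (`…TphiSeminorm`, `…TphiCalculus`, `…TestFunctionNorm`) and the polymer
vocabulary (`…Polymers`). Slade's Theorem 6.3.1 — the renormalisation-group step whose output is
the named fact `LongRangePhi4.Slade2017_prop822` — is stated in the `𝒲_j` norm on `𝒦_j`; this
file supplies the remaining DEFINITIONS of his §6.2 for the concrete model (fields
`φ : Λ_N → ℝⁿ` on the torus `Λ_N = (ℤ/Mℤ)^d`, `TorusSite d M`, unit steps `±e_i`), with the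
elementary API. Source: G. Slade, Commun. Math. Phys. 358 (2018), arXiv:1611.06169, §6.2.1–6.2.3
(read from the TeX source; display numbers by position: (6.28) `‖g‖_{Φ_j(𝔥_j)}`, (6.29)
`‖φ‖_{Φ_j(ℓ_j)}`, (6.30)/(6.30') the local norms, (6.32) regulators, (6.33) regulator norms,
(6.35) `ℱ_j`, `𝒲_j`), which "recall[s] the definitions of several norms from [BS-rg-norm,
BS-rg-step]" (Brydges–Slade, J. Stat. Phys. 159 (2015) 421–460, §3.5, §3.7).

## What this file provides (definitions with their elementary properties; no named fact)

* `unitStep` (`±e_i`), `fieldFn` (the field as a function on `𝚲 = Λ × {1,…,n}`), `basisDir` (the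
  coordinate directions `e_{(x,i)}`), `prog1`/`adm_prog1` (one-argument programmes `∇^a`).
* **(6.29)** `fieldNorm 𝔥 R pΦ φ = 𝔥⁻¹ sup_{x,i,|a| ≤ p_Φ} R^{|a|}|∇^a φ^i_x|` (`R = L^j`; a
  finite supremum: `fieldNormSet_finite`, `le_fieldNorm`, `fieldNorm_nonneg`), the link with the
  unit-ball estimates of the test-function norm (`napply_le_of_fieldNorm_le`:
  `‖φ‖_Φ ≤ C ⇒ |∇^β φ_x| ≤ C𝔥R^{-|β|}`), the constant field (`fieldNorm_const_le`, Slade (8.25)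
  "`‖𝟙‖_{Φ_N} = ℓ_N⁻¹`"), and **Slade (8.24)** in these terms (`abs_iteratedFDeriv_two_le_fieldNorm`:
  `|D²F(φ; f, f)| ≤ 2‖F‖_{T_{φ,j}(𝔥)}‖f‖²_{Φ_j(𝔥)}`).
* **(6.30)** `localFieldNorm` (`inf` over fields agreeing with `φ` on `X`), **(6.30')**
  `localFieldNormTilde` (`inf` over `f` affine on `X`, `IsAffineOn`, in the relative coordinates of
  minimal absolute value — the "linear function on `X`" for sets not wrapping around the torus).
* **(6.32)** `fluctReg` (`G_j(X,φ) = ∏_{x∈X} e^{L^{-dj}‖φ‖²_{Φ_j(B_x^□,ℓ_j)}}`), `largeReg` (`G̃_j`),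
  with `G ≥ 1`, `G(∅) = 1`, multiplicativity over disjoint unions.
* **(6.33)** `regNorm` (`‖F‖_𝒢 = sup_φ ‖F‖_{T_{φ,j}(𝔥)}/𝒢(X,φ)`, `[0,∞]`-valued;
  `TphiNorm_le_of_regNorm_le`), **(6.35)** `largePolymerExp` (`f_j(X) = r(|X|_j - 2^d)_+`),
  `FNorm` (`‖K‖_{ℱ_j(𝒢)} = sup_{X ∈ 𝒞_j} (1/ϑ̄)^{f_j(X)}‖K(X)‖_𝒢`) and `WNorm`
  (`‖K‖_{𝒲_j} = max{‖K‖_{ℱ(G)}, γ_j³‖K‖_{ℱ(G̃^γ)}}`).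

The scale-dependent parameters (`ℓ_j`, `h_j`, `ϑ_j`, `γ_j`, `ε̄`, (6.31), (6.34)) are left as
arguments. Ledger effect: none on the trust base of the barrier's reduction chain
(`Slade2017_prop822`).
-/

noncomputable section

namespace Literature.Barriers.CriticalPhenomena

namespace LongRangePhi4

open Finset

namespace RGNorm

open Tphi Polymer Literature.Probability.LatticeModels
open scoped ContDiff ENNReal

variable {d M n : ℕ} [NeZero M]

/-! ### The field as a test function; unit steps; one-argument programmes -/

/-- The `2d` unit steps `±e_i` of the torus. [cite: BrydgesSlade2015RGI, §3.3 ("𝒰 = {±e_1,…,±e_d}")] -/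
def unitStep (d M : ℕ) : Fin d × Bool → TorusSite d M := fun p => Pi.single p.1 (if p.2 then 1 else -1)

/-- The field `φ : Λ → ℝⁿ` as a function on field labels `𝚲 = Λ × {1,…,n}`. [folklore] -/
def fieldFn (φ : TorusSite d M → Fin n → ℝ) : TorusSite d M × Fin n → ℝ := fun p => φ p.1 p.2

/-- The coordinate directions `e_{(x,i)}` in the space of fields. [folklore] -/
def basisDir (d M n : ℕ) : TorusSite d M × Fin n → (TorusSite d M → Fin n → ℝ) :=
  fun p y j => if y = p.1 ∧ j = p.2 then 1 else 0

/-- A one-argument derivative programme `∇^a` (all differences act on the single argument). [folklore] -/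
def prog1 (l : List (Fin d × Bool)) : List (ℕ × (Fin d × Bool)) := l.map fun s => (0, s)

omit [NeZero M] in
/-- One-argument programmes of order `≤ p_Φ` are admissible for sequences of length one. [folklore] -/
theorem adm_prog1 {pΦ : ℕ} {l : List (Fin d × Bool)} (hl : l.length ≤ pΦ) : Adm pΦ 1 (prog1 l) := by
  refine ⟨fun q hq => ?_, fun p => ?_⟩
  · simp only [prog1, List.mem_map] at hq
    obtain ⟨s, _, rfl⟩ := hq
    exact Nat.zero_lt_one
  · unfold countAt prog1
    rw [List.map_map]
    refine le_trans (List.count_le_length) ?_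
    simpa using hl

/-! ### The norm of the field (6.29) and its local versions (6.30) -/

/-- The set of values `𝔥⁻¹ R^{|a|} |∇^a φ^i_x|` over `x ∈ Λ`, `i`, `|a| ≤ p_Φ`. [folklore] -/
def fieldNormSet (𝔥 R : ℝ) (pΦ : ℕ) (φ : TorusSite d M → Fin n → ℝ) : Set ℝ :=
  {t | ∃ (p : TorusSite d M × Fin n) (l : List (Fin d × Bool)), l.length ≤ pΦ ∧
    t = 𝔥⁻¹ * R ^ l.length * |napply (unitStep d M) (prog1 l) (liftFn (fieldFn φ)) [p]|}

/-- **The norm of the field regarded as a test function** (Slade (6.29)):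
`‖φ‖_{Φ_j(𝔥)} = 𝔥⁻¹ sup_{x} sup_{i} sup_{|a| ≤ p_Φ} L^{j|a|} |∇^a φ^i_x|` (`R = L^j`).
[cite: Slade2017, §6.2.1 (display (6.29))] [cite: BrydgesSlade2015RGI, Example 3.3.2] -/
def fieldNorm (𝔥 R : ℝ) (pΦ : ℕ) (φ : TorusSite d M → Fin n → ℝ) : ℝ := sSup (fieldNormSet 𝔥 R pΦ φ)

omit [NeZero M] in
/-- The index set of (6.29) is finite. [folklore] -/
theorem fieldNormSet_finite [NeZero M] (𝔥 R : ℝ) (pΦ : ℕ) (φ : TorusSite d M → Fin n → ℝ) :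
    (fieldNormSet 𝔥 R pΦ φ).Finite := by
  have hfin : {l : List (Fin d × Bool) | l.length ≤ pΦ}.Finite := List.finite_length_le _ _
  refine ((Set.finite_univ (α := TorusSite d M × Fin n)).prod hfin).image
    (fun q : (TorusSite d M × Fin n) × List (Fin d × Bool) =>
      𝔥⁻¹ * R ^ q.2.length * |napply (unitStep d M) (prog1 q.2) (liftFn (fieldFn φ)) [q.1]|) |>.subset ?_
  rintro t ⟨p, l, hl, rfl⟩
  exact ⟨(p, l), ⟨Set.mem_univ _, hl⟩, rfl⟩

/-- The values in (6.29) are bounded by the norm. [folklore] -/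
theorem le_fieldNorm {𝔥 R : ℝ} {pΦ : ℕ} (φ : TorusSite d M → Fin n → ℝ) (p : TorusSite d M × Fin n)
    {l : List (Fin d × Bool)} (hl : l.length ≤ pΦ) :
    𝔥⁻¹ * R ^ l.length * |napply (unitStep d M) (prog1 l) (liftFn (fieldFn φ)) [p]| ≤ fieldNorm 𝔥 R pΦ φ :=
  le_csSup (fieldNormSet_finite 𝔥 R pΦ φ).bddAbove ⟨p, l, hl, rfl⟩

/-- `0 ≤ ‖φ‖_{Φ_j}` (for `𝔥 > 0`... in general the empty programme at any point gives `𝔥⁻¹|φ|`;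
nonnegativity holds as a supremum of absolute values when `𝔥, R ≥ 0`). [folklore] -/
theorem fieldNorm_nonneg [Nonempty (Fin n)] {𝔥 R : ℝ} (h𝔥 : 0 ≤ 𝔥) (pΦ : ℕ) (φ : TorusSite d M → Fin n → ℝ) :
    0 ≤ fieldNorm 𝔥 R pΦ φ := by
  obtain ⟨i⟩ := ‹Nonempty (Fin n)›
  have h := le_fieldNorm (𝔥 := 𝔥) (R := R) φ ((fun _ => 0), i) (l := []) (Nat.zero_le pΦ)
  refine le_trans ?_ h
  simp only [List.length_nil, pow_zero, mul_one]
  exact mul_nonneg (inv_nonneg.2 h𝔥) (abs_nonneg _)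

/-- **The local norm** `‖φ‖_{Φ_j(X,𝔥)} = inf{‖φ - f‖_{Φ_j(𝔥)} : f_x = 0 ∀ x ∈ X}` (Slade (6.30)) —
equivalently the infimum of `‖ψ‖` over the fields `ψ` agreeing with `φ` on `X`.
[cite: Slade2017, §6.2.1 (display (6.30))] [cite: BrydgesSlade2015RGI, §3.5 (display (PhiXdef))] -/
def localFieldNorm (𝔥 R : ℝ) (pΦ : ℕ) (X : Finset (TorusSite d M)) (φ : TorusSite d M → Fin n → ℝ) : ℝ :=
  sInf ((fieldNorm 𝔥 R pΦ) '' {ψ | ∀ x ∈ X, ψ x = φ x})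

/-- `‖φ‖_{Φ_j(X)} ≤ ‖φ‖_{Φ_j}`. [folklore] -/
theorem localFieldNorm_le [Nonempty (Fin n)] {𝔥 R : ℝ} (h𝔥 : 0 ≤ 𝔥) (pΦ : ℕ) (X : Finset (TorusSite d M))
    (φ : TorusSite d M → Fin n → ℝ) : localFieldNorm 𝔥 R pΦ X φ ≤ fieldNorm 𝔥 R pΦ φ :=
  csInf_le ⟨0, by rintro _ ⟨ψ, _, rfl⟩; exact fieldNorm_nonneg h𝔥 pΦ ψ⟩ ⟨φ, fun _ _ => rfl, rfl⟩

/-- `0 ≤ ‖φ‖_{Φ_j(X)}`. [folklore] -/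
theorem localFieldNorm_nonneg [Nonempty (Fin n)] {𝔥 R : ℝ} (h𝔥 : 0 ≤ 𝔥) (pΦ : ℕ) (X : Finset (TorusSite d M))
    (φ : TorusSite d M → Fin n → ℝ) : 0 ≤ localFieldNorm 𝔥 R pΦ X φ :=
  le_csInf ⟨_, ⟨φ, fun _ _ => rfl, rfl⟩⟩ (by rintro _ ⟨ψ, _, rfl⟩; exact fieldNorm_nonneg h𝔥 pΦ ψ)

/-- A field is **affine on `X`** (the "`f|_X` is a linear function" of Slade (6.30'), for sets
`X` small enough not to wrap around the torus): in relative coordinates of minimal absolute value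
around a base point of `X`, `f_x = a + Σ_i (x - x_0)_i c_i`. [cite: Slade2017, §6.2.1 (display (6.30'), "f|_X is a linear function")] -/
def IsAffineOn (X : Finset (TorusSite d M)) (f : TorusSite d M → Fin n → ℝ) : Prop :=
  ∃ x₀ ∈ X, ∃ (a : Fin n → ℝ) (c : Fin d → Fin n → ℝ),
    ∀ x ∈ X, f x = a + ∑ i, (ZMod.valMinAbs (x i - x₀ i) : ℝ) • c i

/-- **The second local norm** `‖φ‖_{Φ̃_j(X,𝔥)} = inf{‖φ - f‖_{Φ_j(𝔥)} : f|_X linear}`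
(Slade (6.30')). [cite: Slade2017, §6.2.1 (display (6.30'))] -/
def localFieldNormTilde (𝔥 R : ℝ) (pΦ : ℕ) (X : Finset (TorusSite d M)) (φ : TorusSite d M → Fin n → ℝ) : ℝ :=
  sInf ((fun f => fieldNorm 𝔥 R pΦ (φ - f)) '' {f | IsAffineOn X f})

/-! ### Regulators (6.32) -/

/-- **The fluctuation-field regulator** `G_j(X,φ) = ∏_{x ∈ X} exp(L^{-dj}‖φ‖²_{Φ_j(B_x^□,ℓ_j)})`
(`b = L^j` the block side). [cite: Slade2017, §6.2.2 (display (6.32), G_j)] -/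
def fluctReg (b : ℕ) (ℓ R : ℝ) (pΦ : ℕ) (X : Finset (TorusSite d M)) (φ : TorusSite d M → Fin n → ℝ) : ℝ :=
  Real.exp (∑ x ∈ X, ((b : ℝ) ^ d)⁻¹ * localFieldNorm ℓ R pΦ (sclosure b (block b x)) φ ^ 2)

/-- **The large-field regulator** `G̃_j(X,φ) = ∏_{x ∈ X} exp(½ L^{-dj}‖φ‖²_{Φ̃_j(B_x^□,ℓ_j)})`.
[cite: Slade2017, §6.2.2 (display (6.32), G̃_j)] -/
def largeReg (b : ℕ) (ℓ R : ℝ) (pΦ : ℕ) (X : Finset (TorusSite d M)) (φ : TorusSite d M → Fin n → ℝ) : ℝ :=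
  Real.exp (∑ x ∈ X, 2⁻¹ * ((b : ℝ) ^ d)⁻¹ * localFieldNormTilde ℓ R pΦ (sclosure b (block b x)) φ ^ 2)

/-- Regulators are `≥ 1`. [folklore] -/
theorem one_le_fluctReg (b : ℕ) (ℓ R : ℝ) (pΦ : ℕ) (X : Finset (TorusSite d M)) (φ : TorusSite d M → Fin n → ℝ) :
    1 ≤ fluctReg b ℓ R pΦ X φ :=
  Real.one_le_exp (Finset.sum_nonneg fun _ _ => mul_nonneg (by positivity) (sq_nonneg _))

/-- `G_j(∅, φ) = 1`. [folklore] -/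
@[simp] theorem fluctReg_empty (b : ℕ) (ℓ R : ℝ) (pΦ : ℕ) (φ : TorusSite d M → Fin n → ℝ) :
    fluctReg b ℓ R pΦ ∅ φ = 1 := by simp [fluctReg]

/-- `G_j(X ∪ Y) = G_j(X)G_j(Y)` for disjoint `X, Y`. [folklore] -/
theorem fluctReg_union (b : ℕ) (ℓ R : ℝ) (pΦ : ℕ) {X Y : Finset (TorusSite d M)} (h : Disjoint X Y)
    (φ : TorusSite d M → Fin n → ℝ) : fluctReg b ℓ R pΦ (X ∪ Y) φ = fluctReg b ℓ R pΦ X φ * fluctReg b ℓ R pΦ Y φ := by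
  rw [fluctReg, fluctReg, fluctReg, Finset.sum_union h, Real.exp_add]

/-- `G̃_j(∅, φ) = 1`. [folklore] -/
@[simp] theorem largeReg_empty (b : ℕ) (ℓ R : ℝ) (pΦ : ℕ) (φ : TorusSite d M → Fin n → ℝ) :
    largeReg b ℓ R pΦ ∅ φ = 1 := by simp [largeReg]

/-- Large-field regulators are positive. [folklore] -/
theorem largeReg_pos (b : ℕ) (ℓ R : ℝ) (pΦ : ℕ) (X : Finset (TorusSite d M)) (φ : TorusSite d M → Fin n → ℝ) :
    0 < largeReg b ℓ R pΦ X φ := Real.exp_pos _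

/-! ### Regulator norms (6.33), the `ℱ_j` and `𝒲_j` norms (6.35) -/

/-- **The regulator norm** `‖F‖_{𝒢} = sup_{φ} ‖F‖_{T_{φ,j}(𝔥)} / 𝒢(X,φ)` for a regulator
`𝒢 = G_j` or `G̃_j^γ` (Slade (6.33)), with values in `[0,∞]`.
[cite: Slade2017, §6.2.2 (display (6.33))] [cite: BrydgesSlade2015RGI, Definition 3.7.3 area (‖F‖_{T_{φ}}G^{-1} norms)] -/
def regNorm (𝔥 R : ℝ) (pΦ pN : ℕ) (𝒢 : (TorusSite d M → Fin n → ℝ) → ℝ)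
    (F : (TorusSite d M → Fin n → ℝ) → ℝ) : ℝ≥0∞ :=
  ⨆ φ : TorusSite d M → Fin n → ℝ,
    ENNReal.ofReal (TphiNorm pN (latticeFamily (unitStep d M) 𝔥 R pΦ) (basisDir d M n) F φ / 𝒢 φ)

/-- The pointwise bound encoded by a finite regulator norm: `‖F‖_{T_φ} ≤ ‖F‖_𝒢 · 𝒢(φ)`. [folklore] -/
theorem TphiNorm_le_of_regNorm_le {𝔥 R : ℝ} {pΦ pN : ℕ} {𝒢 : (TorusSite d M → Fin n → ℝ) → ℝ}
    (h𝒢 : ∀ φ, 0 < 𝒢 φ) {F : (TorusSite d M → Fin n → ℝ) → ℝ} {A : ℝ} (hA : 0 ≤ A)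
    (h : regNorm 𝔥 R pΦ pN 𝒢 F ≤ ENNReal.ofReal A) (φ : TorusSite d M → Fin n → ℝ) :
    TphiNorm pN (latticeFamily (unitStep d M) 𝔥 R pΦ) (basisDir d M n) F φ ≤ A * 𝒢 φ := by
  have h1 : ENNReal.ofReal (TphiNorm pN (latticeFamily (unitStep d M) 𝔥 R pΦ) (basisDir d M n) F φ / 𝒢 φ)
      ≤ ENNReal.ofReal A := (le_iSup _ φ).trans h
  rw [ENNReal.ofReal_le_ofReal_iff hA, div_le_iff₀ (h𝒢 φ)] at h1
  exact h1

/-- The large-polymer weight exponent `f_j(X) = r(|X|_j - 2^d)_+`. [cite: Slade2017, §6.2.3 ("we fix r ∈ (0, ¼2^{-d}) and set f_j(X) = r(|X|_j - 2^d)_+")] -/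
def largePolymerExp (r : ℝ) (b : ℕ) (X : Finset (TorusSite d M)) : ℝ := r * ((numBlocks b X : ℝ) - 2 ^ d) ⊔ 0

open Classical in
/-- **The `ℱ_j(𝒢_j)` norm** `‖K‖_{ℱ_j(𝒢_j)} = sup_{X ∈ 𝒞_j} (1/ϑ̄)^{f_j(X)} ‖K(X)‖_{𝒢_j}` over
connected polymers (Slade (6.35), first display). [cite: Slade2017, §6.2.3 (display (6.35))] -/
def FNorm (b : ℕ) (𝔥 R : ℝ) (pΦ pN : ℕ) (r ϑbar : ℝ)
    (𝒢 : Finset (TorusSite d M) → (TorusSite d M → Fin n → ℝ) → ℝ)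
    (K : Finset (TorusSite d M) → (TorusSite d M → Fin n → ℝ) → ℝ) : ℝ≥0∞ :=
  ⨆ X ∈ (Finset.univ.filter fun X : Finset (TorusSite d M) => IsPolymer b X ∧ IsConn X),
    ENNReal.ofReal (ϑbar⁻¹ ^ largePolymerExp r b X) * regNorm 𝔥 R pΦ pN (𝒢 X) (K X)

/-- **The `𝒲_j` norm** `‖K‖_{𝒲_j} = max{‖K‖_{ℱ_j(G)}, γ_j³ ‖K‖_{ℱ_j(G̃)}}` (Slade (6.35), last
display; `γ_j = s̄^{3/4}… ` below the mass scale and `0` above, where the norm is just the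
`ℱ(G)` norm), with the two regulators `G_j(ℓ_j)` and `G̃_j^γ(h_j)`.
[cite: Slade2017, §6.2.3 (display defining ‖K‖_{𝒲_j})] -/
def WNorm (b : ℕ) (ℓ h R : ℝ) (pΦ pN : ℕ) (r ϑbar γ γpow : ℝ)
    (K : Finset (TorusSite d M) → (TorusSite d M → Fin n → ℝ) → ℝ) : ℝ≥0∞ :=
  max (FNorm b ℓ R pΦ pN r ϑbar (fun X φ => fluctReg b ℓ R pΦ X φ) K)
    (ENNReal.ofReal (γ ^ 3) * FNorm b h R pΦ pN r ϑbar (fun X φ => largeReg b ℓ R pΦ X φ ^ γpow) K)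


/-! ### From the field norm to the unit-ball estimates; constants; Slade (8.24)–(8.25) -/

omit [NeZero M] in
/-- A programme acting on a one-letter sequence with all positions `0` is a one-argument programme. [folklore] -/
theorem eq_prog1_of_adm {pΦ : ℕ} {β : List (ℕ × (Fin d × Bool))} (hβ : Adm pΦ 1 β) :
    β = prog1 (β.map Prod.snd) ∧ (β.map Prod.snd).length ≤ pΦ := by
  have h0 : ∀ q ∈ β, q.1 = 0 := fun q hq => Nat.lt_one_iff.1 (hβ.1 q hq)
  constructor
  · unfold prog1
    rw [List.map_map]
    conv_lhs => rw [← List.map_id β]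
    refine List.map_congr_left fun q hq => ?_
    ext <;> simp [h0 q hq]
  · have hc := hβ.2 0
    unfold countAt at hc
    rw [List.count_eq_length.2 (fun a ha => ?_)] at hc
    · simpa using hc
    · rw [List.mem_map] at ha
      obtain ⟨q, hq, rfl⟩ := ha
      exact (h0 q hq).symm ▸ rfl

/-- **`‖φ‖_{Φ_j} ≤ C` gives the unit-ball estimates** `|∇^β φ_x| ≤ C 𝔥 R^{-|β|}` for admissible
`β` (the form consumed by `prodFn_polar` / `abs_iteratedFDeriv_two_le_lattice`). [folklore] -/
theorem napply_le_of_fieldNorm_le {𝔥 R : ℝ} (h𝔥 : 0 < 𝔥) (hR : 0 < R) {pΦ : ℕ}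
    {φ : TorusSite d M → Fin n → ℝ} {C : ℝ} (hC : fieldNorm 𝔥 R pΦ φ ≤ C)
    (p : TorusSite d M × Fin n) (β : List (ℕ × (Fin d × Bool))) (hβ : Adm pΦ 1 β) :
    |napply (unitStep d M) β (liftFn (fieldFn φ)) [p]| ≤ C * 𝔥 * (R ^ β.length)⁻¹ := by
  obtain ⟨hβeq, hl⟩ := eq_prog1_of_adm hβ
  have h := (le_fieldNorm (𝔥 := 𝔥) (R := R) φ p hl).trans hC
  rw [← hβeq] at h
  have hlen : (β.map Prod.snd).length = β.length := List.length_map _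
  rw [hlen] at h
  have h1 : 0 < R ^ β.length := pow_pos hR _
  rw [mul_assoc, inv_mul_le_iff₀ h𝔥] at h
  rw [le_mul_inv_iff₀ h1]
  linarith [h]

/-- The field is the combination `Σ_{(x,i)} φ^i_x e_{(x,i)}` of the coordinate directions. [folklore] -/
theorem sum_fieldFn_smul_basisDir (φ : TorusSite d M → Fin n → ℝ) :
    ∑ p : TorusSite d M × Fin n, fieldFn φ p • basisDir d M n p = φ := by
  funext y j
  simp only [Finset.sum_apply, Pi.smul_apply, basisDir, fieldFn, smul_eq_mul, mul_ite, mul_one, mul_zero]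
  rw [Finset.sum_eq_single (y, j)]
  · simp
  · rintro ⟨x, i⟩ _ hne
    rw [if_neg]
    rintro ⟨rfl, rfl⟩
    exact hne rfl
  · intro h; exact absurd (Finset.mem_univ _) h

/-- **Slade (8.24) for the field norm**: `|D²F(φ; f, f)| ≤ 2 ‖F‖_{T_{φ,j}(𝔥)} ‖f‖²_{Φ_j(𝔥)}` for a
smooth `F` and a field direction `f` (`p_𝒩 ≥ 2`).
[cite: Slade2017, §8.1 (proof of Corollary 8.1.6, display (8.24))] -/
theorem abs_iteratedFDeriv_two_le_fieldNorm {𝔥 R : ℝ} (h𝔥 : 0 < 𝔥) (hR : 0 < R) {pΦ pN : ℕ}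
    (hpN : 2 ≤ pN) {F : (TorusSite d M → Fin n → ℝ) → ℝ} (hF : ContDiff ℝ ∞ F)
    (φ f : TorusSite d M → Fin n → ℝ) [Nonempty (Fin n)] :
    |iteratedFDeriv ℝ 2 F φ (fun _ => f)| ≤
      2 * TphiNorm pN (latticeFamily (unitStep d M) 𝔥 R pΦ) (basisDir d M n) F φ *
        fieldNorm 𝔥 R pΦ f ^ 2 := by
  have h := abs_iteratedFDeriv_two_le_lattice (unitStep d M) h𝔥 hR hpN (basisDir d M n) hF φ
    (fieldFn f) (c := fieldNorm 𝔥 R pΦ f) (fieldNorm_nonneg h𝔥.le pΦ f)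
    (fun x β hβ => napply_le_of_fieldNorm_le h𝔥 hR le_rfl x β hβ)
  rwa [sum_fieldFn_smul_basisDir] at h

omit [NeZero M] in
/-- Finite differences of an `x`-independent test function vanish: `∇^a` of a constant (in `x`)
one-letter test function is the function itself for `a = ∅` and `0` otherwise. [folklore] -/
theorem napply_prog1_const {g : List (TorusSite d M × Fin n) → ℝ}
    (hg : ∀ (x y : TorusSite d M) (i : Fin n), g [(x, i)] = g [(y, i)]) :
    ∀ (l : List (Fin d × Bool)) (p : TorusSite d M × Fin n),
      napply (unitStep d M) (prog1 l) g [p] = if l = [] then g [p] else 0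
  | [], p => by simp [prog1]
  | s :: l, p => by
      have ih := napply_prog1_const hg l
      simp only [prog1, List.map_cons] at ih ⊢
      rw [napply_cons, diffOp]
      simp only [shiftAt, List.modify_zero_cons, reduceCtorEq, ↓reduceIte]
      rw [ih, ih]
      split_ifs with h
      · subst h; rw [hg]; ring
      · ring

omit [NeZero M] in
/-- **The norm of a constant field** ("the norm of the constant test function `𝟙 ∈ Φ_N` is
`‖𝟙‖_{Φ_N} = ℓ_N⁻¹ sup_x |𝟙_x| = ℓ_N⁻¹`", Slade (8.25)): `‖v‖_{Φ_j(𝔥)} ≤ 𝔥⁻¹ max_i |v_i|` for a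
constant field `φ_x = v`. [cite: Slade2017, §8.1 (proof of Corollary 8.1.6, display (8.25))] -/
theorem fieldNorm_const_le {𝔥 R : ℝ} (h𝔥 : 0 ≤ 𝔥) (pΦ : ℕ) (v : Fin n → ℝ) {C : ℝ}
    (hv : ∀ i, |v i| ≤ C) [Nonempty (Fin n)] :
    fieldNorm 𝔥 R pΦ (fun _ : TorusSite d M => v) ≤ 𝔥⁻¹ * C := by
  have hC : 0 ≤ C := (abs_nonneg _).trans (hv (Classical.arbitrary _))
  refine csSup_le ?_ ?_
  · obtain ⟨i⟩ := ‹Nonempty (Fin n)›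
    exact ⟨_, ⟨((fun _ => 0), i), [], Nat.zero_le _, rfl⟩⟩
  · rintro _ ⟨p, l, _, rfl⟩
    rw [napply_prog1_const (fun x y i => rfl)]
    split_ifs with h
    · subst h
      simp only [List.length_nil, pow_zero, mul_one, liftFn_singleton, fieldFn]
      exact mul_le_mul_of_nonneg_left (hv p.2) (inv_nonneg.2 h𝔥)
    · simp only [abs_zero, mul_zero]
      exact mul_nonneg (inv_nonneg.2 h𝔥) hC

end RGNorm

end LongRangePhi4

end Literature.Barriers.CriticalPhenomena

end
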